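import Summits.QuantumFields.YangMills.Theorems.BalabanUVNodesN15TwoSpacingGluingRecordKnitNode
import Summits.QuantumFields.YangMills.Theorems.BalabanUVNodesN15TwoSpacingGluingRecordKnitEntryThree
import HarnessLib

/-!
# THE GLUING STEP AT TWO LATTICE SPACINGS, LXXIII: `NE2PlusOperator` FOR THE RECORD COVER's GLUED `U ≡ 1` PAIR ON THE TORUS OF RECORD — `M = L^s` LIVE, VOLUME `m_T` FREE, NO DISPLAYED ROW
# (dag-n15-c g14, FILE 116; N15 = NE2, s1 «background-layer OPERATOR ingredient»)

Cell `pub-ymgap`, seat `pub-ymgap-dag-n15-c` (R134 (a); HUMAN RULING D-0062), generation 14.  `bears_on: R4∕N15 · K3⁸ SpineGivenEndpointR13SepCoPHV (stmt-QuantumFields-27366)`.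
Filed `--supports stmt-QuantumFields-27366 --as helper` — COUNT-NEUTRAL.  Theorems only (0 `def`, 0 `sorry`).  Imports BY NAME FILE 115 `…RecordKnitNode` (★★★ `ne2PlusOperator_knitR_of_entryThree`,
the record family `knitInstanceR ∕ knitFamilyR`) and dag-n15-w5 g5's `…RecordKnitEntryThree` (86R∕88R: ★★★ `hasMaj_lap_parametrix_knitR`, ★★★ `hasMaj_idef_lap_parametrix_knitR` — the entry-3
pair of the record cover, the two binders of FILES 114∕115); nothing in the tree is modified.

WHAT.  ★★★ **`ne2PlusOperator_knitR`** — PROGRAMME R CLOSED: for `d ≥ 1`, odd `L ≥ 3`, `a > 0` and any `c₃₅, θc, θ`: `NE2PlusOperator c₃₅ (knitInstanceR hL θc θ) (knitFamilyR hL a θc θ)` with NO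
displayed hypothesis — FILE 50's socket called on the glued `U ≡ 1` pair of the RECORD cover (dag-n15-a's LIFTED Neumann cubes `knitGR` of side `L^{s+1}` on the torus of record `2L^{m_T}`, partition
`knitHR`), the [B9] size parameter `M = L^s` LIVE (`knitInstanceR_gf_M`, unbounded over the family) and the VOLUME `m_T ≥ s + 1` FREE: the torus is no longer the cube's double.  All fourteen rows
of the bundle are tree theorems: FILES 109–113 (entries 0∕1∕2 and the left remainder, record twins of FILES 84∕85∕89∕90∕91), dag-n15-w5's 86R∕88R (entry 3), FILES 103∕104∕108 (the right half).
`ne2ZeroOperator_knitR` (`θ ≥ 0`; `T4EtaRate.ne2Zero_of_ne2Plus` at `c₃₅ = 1`, as FILE 101 v1.1) and the `d + 1 = 4` instances.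

HONEST FRAMING ∕ LIMITS.  Block-majorant bookkeeping over LANDED rows + FILE 50's socket; `U ≡ 1` MODEL of [B6] §2's machine on the torus of record (cube letters from each cube's own doubled
torus via programme P — not circular in the volume); the predicate `NE2PlusOperator` is the tree's HYPOTHESIS SHAPE, NOT [B9]'s printed statement (no `Q(U)`, the entries do not depend on the
background `U`); constants crude and ours; nothing of [B5]∕[B6] (2.38)–(2.40)∕[B9] Thm 3.1, 3.14 asserted.  NE2⁺ AS PRINTED is NOT proved; N15 NOT discharged; counts of record UNMOVED (typed
28∕28 · discharged 5∕27); every index is a finite torus `2L^{m_T}` at fixed spacings — «volume free» means UNIFORM in the finite volume, NOT infinite volume, NOT OS on ℝ⁴, NOT a mass gap, NOT Clay;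
R4 closes `BalabanLadder.UV` only.  Restate-immune (no Theses import).
-/

noncomputable section

namespace Summit.QuantumFields.YangMills.BalabanUVNodes.N15.Gluing

open Literature.MathematicalPhysics.QuantumFieldTheory.Balaban1983to89.T4EtaRate (NE2PlusOperator)

variable {d : ℕ} {L : ℕ} [NeZero L]

/-- ★★★ **NE2⁺, OPERATOR LAYER, BY NAME, FOR THE RECORD COVER's GLUED `U ≡ 1` PAIR ON THE TORUS OF RECORD — `(gf i).M := L^s` LIVE, VOLUME FREE, NO DISPLAYED ROW.**  For `d ≥ 1`, odd
`L ≥ 3`, `a > 0` and any `c₃₅, θc, θ`: `NE2PlusOperator c₃₅ (knitInstanceR hL θc θ) (knitFamilyR hL a θc θ)` — FILE 115 `ne2PlusOperator_knitR_of_entryThree` fed with dag-n15-w5's entry-3 pair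
`hasMaj_lap_parametrix_knitR` ∕ `hasMaj_idef_lap_parametrix_knitR`. [cite: Balaban1985BackgroundPropagators, Thm 3.1 p.397 (quantifier template «M ≥ M₁ … Mα₀ ≤ a₀»), Thm 3.14 pp.426–427
(difference template); Balaban1984PropagatorsII, Prop. 2.6 (2.135)–(2.136) p.247 (mechanism), (2.91)–(2.93) p.239; King1986, Prop. 3.9 (3.73) p.665 (rate factor)] -/
theorem ne2PlusOperator_knitR (hd1 : 1 ≤ d) (hL : Odd L ∧ 1 < L) {a : ℝ} (ha : 0 < a) (c35 θc θ : ℝ) :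
    NE2PlusOperator c35 (knitInstanceR (d := d) hL θc θ) (knitFamilyR (d := d) hL a θc θ) :=
  ne2PlusOperator_knitR_of_entryThree (d := d) hd1 hL ha c35 θc θ (hasMaj_lap_parametrix_knitR (d := d) hL ha) (hasMaj_idef_lap_parametrix_knitR (d := d) hL ha)

/-- The four-dimensional instance (`d + 1 = 4`): `NE2PlusOperator c₃₅ (knitInstanceR hL θc θ) (knitFamilyR hL a θc θ)` on the tori of record `2L^{m_T}` of `𝕋⁴`-type, no displayed row.
[cite: Balaban1985BackgroundPropagators, Thm 3.1 p.397 (quantifier template)] -/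
theorem ne2PlusOperator_knitR_dim4 (hL : Odd L ∧ 1 < L) {a : ℝ} (ha : 0 < a) (c35 θc θ : ℝ) :
    NE2PlusOperator c35 (knitInstanceR (d := 3) hL θc θ) (knitFamilyR (d := 3) hL a θc θ) :=
  ne2PlusOperator_knitR (d := 3) (by norm_num) hL ha c35 θc θ

section Zero

open Literature.MathematicalPhysics.QuantumFieldTheory.Balaban1983to89.T4EtaRate (NE2ZeroOperator ne2Zero_of_ne2Plus)

/-- ★★ **NE2⁰ FOR THE SAME RECORD FAMILY — `T4EtaRate.NE2ZeroOperator` BY NAME**: at the fine carrier's trivial configuration (`coeffBg.one = 0`; (3.35) holds there for every `α₀ > 0` since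
`M = L^s > 0` and `θ ≥ 0`) the record glued family obeys `EtaRateIneq342` with the size guard `M₅ ≤ L^s` live — `T4EtaRate.ne2Zero_of_ne2Plus` at `c₃₅ = 1`.
[cite: King1986, Props. 3.8–3.9 (3.71)–(3.75) pp.664–665 (A = 0 model); Balaban1985BackgroundPropagators, Thm 3.1 p.397 (quantifier template)] -/
theorem ne2ZeroOperator_knitR (hd1 : 1 ≤ d) (hL : Odd L ∧ 1 < L) {a : ℝ} (ha : 0 < a) (θc θ : ℝ) (hθ : 0 ≤ θ) :
    NE2ZeroOperator (knitInstanceR (d := d) hL θc θ) (knitFamilyR (d := d) hL a θc θ) := by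
  refine ne2Zero_of_ne2Plus (c35 := 1) (fun i α₀ hα₀ => ?_) (ne2PlusOperator_knitR (d := d) hd1 hL ha 1 θc θ)
  have hL0 : (0 : ℝ) < L := by exact_mod_cast (show 0 < L by have := hL.2; omega)
  have hM : 0 ≤ (1 : ℝ) * (L : ℝ) ^ i.s * α₀ := by positivity
  refine ⟨fun x' => ?_, fun x₁ x₂ _ => ?_⟩
  · show |(0 : ℝ)| ≤ 1 * (L : ℝ) ^ i.s * α₀
    rw [abs_zero]
    exact hM
  · show |(0 : ℝ) - 0| ≤ 1 * (L : ℝ) ^ i.s * α₀ * θ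
    rw [sub_zero, abs_zero]
    exact mul_nonneg hM hθ

/-- The four-dimensional instance of the NE2⁰ corollary. [cite: King1986, Props. 3.8–3.9 (3.71)–(3.75) pp.664–665 (A = 0 model)] -/
theorem ne2ZeroOperator_knitR_dim4 (hL : Odd L ∧ 1 < L) {a : ℝ} (ha : 0 < a) (θc θ : ℝ) (hθ : 0 ≤ θ) :
    NE2ZeroOperator (knitInstanceR (d := 3) hL θc θ) (knitFamilyR (d := 3) hL a θc θ) :=
  ne2ZeroOperator_knitR (d := 3) (by norm_num) hL ha θc θ hθ

end Zero

end Summit.QuantumFields.YangMills.BalabanUVNodes.N15.Gluing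

end
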